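import Mathlib
import Summits.AnomalousDissipation.AnomalousDissipation.Theorems.LimitingAbsorptionScalarSectorLiftRepr
import Literature.Analysis.FluidPDE.PassiveScalarEnergyMollified
import HarnessLib

/-!
# Route LimitingAbsorption — support item `ScalarSectorLift` (stmt-AnomalousDissipation-2941), part C:
# the truncated energy balance of a weak sourced scalar

With the continuous modes `c(t,k)` (part A) of a global weak solution `θ ∈ L^∞_t L²_x` of
`∂ₜθ + u·∇θ = κΔθ + h`, the truncations `P_N(t) = reTrigPoly (freqBall N) (c t)` have energy
`E_N = ∑_{|k|≤N} ‖c(t,k)‖²`, dissipation `D_N = 4π² ∑_{|k|≤N} |k|² ‖c(t,k)‖²`, and satisfy the exact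
truncated balance (Galerkin form of "multiply by `P_N θ` and integrate"; Lions 1960,
Robinson–Rodrigo–Sadowski 2016 Lemma 4.1/Thm. 4.6, Bonicatto–Ciampa–Crippa 2023 proof of Thm. 3.3):
`E_N(t) - E_N(s) = ∫_{(s,t]} Φ_N` with `Φ_N = ∑ 2 Re (conj c · B)` (`ssl_energy_trunc_sub_eq`, the
product formula for primitives mode by mode), and at a.e. time
`Φ_N = -2κ D_N + 2∫ h P_N + 2∫ (θ - P_N)⟪u, ∇P_N⟫` (`ssl_trunc_flux_ae_eq`: the three modal sums in
physical space by Parseval, `∫ P_N⟪u,∇P_N⟫ = 0` by weak incompressibility), with the Young bound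
`|∫ (θ - P_N)⟪u,∇P_N⟫| ≤ (η/2) D_N + (M²/2η)(∫θ² - E_N)` for a drift bounded by `M`.
-/

set_option linter.dupNamespace false

noncomputable section

open scoped BigOperators Topology ENNReal NNReal InnerProductSpace ComplexConjugate
open Filter Set Function MeasureTheory UnitAddTorus Complex

namespace Summit.AnomalousDissipation.AnomalousDissipation.Theorems

open Literature.Analysis Literature.Analysis.FunctionSpaces Literature.Analysis.FunctionSpaces.Torus
open Literature.Analysis.FluidPDE Literature.Analysis.FluidPDE.Torus
open ScalarAnomalySteadySourceFormal.Negative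

variable {d : Type*} [Fintype d]

/-! ### The product formula for primitives, mode by mode -/

omit [Fintype d] in
/-- `Re (conj c · B) = Re c · Re B + Im c · Im B`. [folklore] -/
theorem ssl_re_conj_mul (c B : ℂ) : (conj c * B).re = c.re * B.re + c.im * B.im := by
  simp only [Complex.mul_re, Complex.conj_re, Complex.conj_im]
  ring

omit [Fintype d] in
/-- **The squared modulus of an absolutely continuous complex function**: if
`c(τ) = c(s) + ∫_{(s,τ]} B` for `τ ∈ (s, t]` with `B ∈ L¹(s,t)` and `c` bounded and measurable
there, then `‖c(t)‖² - ‖c(s)‖² = ∫_{(s,t]} 2 Re (conj c · B)` (the elementary product formula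
`(c + ∫g)² = c² + 2∫ g (c + ∫g)` of the tree, `sq_const_add_setIntegral_eq`, on real and
imaginary parts). [folklore] -/
theorem ssl_sq_norm_sub_eq_setIntegral {s t : ℝ} (hst : s ≤ t) {c B : ℝ → ℂ}
    (hB : IntegrableOn B (Ioc s t)) (hcm : AEStronglyMeasurable c (volume.restrict (Ioc s t)))
    {C : ℝ} (hcb : ∀ τ ∈ Ioc s t, ‖c τ‖ ≤ C)
    (hc : ∀ τ ∈ Ioc s t, c τ = c s + ∫ r in Ioc s τ, B r) :
    IntegrableOn (fun τ => 2 * (conj (c τ) * B τ).re) (Ioc s t) ∧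
      ‖c t‖ ^ 2 - ‖c s‖ ^ 2 = ∫ τ in Ioc s t, 2 * (conj (c τ) * B τ).re := by
  have hBre : IntegrableOn (fun τ => (B τ).re) (Ioc s t) := hB.re
  have hBim : IntegrableOn (fun τ => (B τ).im) (Ioc s t) := hB.im
  -- the product `Re (conj c · B)` is integrable (bounded times integrable)
  have hcb' : ∀ᵐ τ ∂(volume.restrict (Ioc s t)), ‖c τ‖ ≤ C := by
    rw [ae_restrict_iff' measurableSet_Ioc]
    exact ae_of_all _ hcb
  have hprod : IntegrableOn (fun τ => conj (c τ) * B τ) (Ioc s t) := by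
    refine hB.bdd_mul (Complex.continuous_conj.comp_aestronglyMeasurable hcm) (c := C) ?_
    filter_upwards [hcb'] with τ hτ
    simpa using hτ
  have hI : IntegrableOn (fun τ => 2 * (conj (c τ) * B τ).re) (Ioc s t) := hprod.re.const_mul 2
  refine ⟨hI, ?_⟩
  rcases eq_or_lt_of_le hst with h | h
  · subst h
    simp
  -- real and imaginary parts
  have hre : ∀ τ ∈ Ioc s t, (c τ).re = (c s).re + ∫ r in Ioc s τ, (B r).re := by
    intro τ hτ
    rw [hc τ hτ, Complex.add_re, re_integral_eq (hB.mono_set (Ioc_subset_Ioc_right hτ.2))]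
  have him : ∀ τ ∈ Ioc s t, (c τ).im = (c s).im + ∫ r in Ioc s τ, (B r).im := by
    intro τ hτ
    rw [hc τ hτ, Complex.add_im, im_integral_eq (hB.mono_set (Ioc_subset_Ioc_right hτ.2))]
  have ht : t ∈ Ioc s t := ⟨h, le_rfl⟩
  have e1 := sq_const_add_setIntegral_eq (c := (c s).re) hBre
  have e2 := sq_const_add_setIntegral_eq (c := (c s).im) hBim
  rw [← hre t ht] at e1
  rw [← him t ht] at e2
  -- replace the inner primitives by `Re c`, `Im c`
  have e1' : ∫ τ in Ioc s t, (B τ).re * ((c s).re + ∫ r in Ioc s τ, (B r).re) =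
      ∫ τ in Ioc s t, (B τ).re * (c τ).re :=
    setIntegral_congr_fun measurableSet_Ioc fun τ hτ => by rw [hre τ hτ]
  have e2' : ∫ τ in Ioc s t, (B τ).im * ((c s).im + ∫ r in Ioc s τ, (B r).im) =
      ∫ τ in Ioc s t, (B τ).im * (c τ).im :=
    setIntegral_congr_fun measurableSet_Ioc fun τ hτ => by rw [him τ hτ]
  rw [e1'] at e1
  rw [e2'] at e2
  -- integrability of the two products
  have hcre : AEStronglyMeasurable (fun τ => (c τ).re) (volume.restrict (Ioc s t)) :=
    Complex.continuous_re.comp_aestronglyMeasurable hcm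
  have hcim : AEStronglyMeasurable (fun τ => (c τ).im) (volume.restrict (Ioc s t)) :=
    Complex.continuous_im.comp_aestronglyMeasurable hcm
  have i1 : IntegrableOn (fun τ => (B τ).re * (c τ).re) (Ioc s t) := by
    have h1 : IntegrableOn (fun τ => (c τ).re * (B τ).re) (Ioc s t) := by
      refine hBre.bdd_mul hcre (c := C) ?_
      filter_upwards [hcb'] with τ hτ
      exact (Complex.abs_re_le_norm _).trans hτ
    exact h1.congr_fun (fun τ _ => mul_comm _ _) measurableSet_Ioc
  have i2 : IntegrableOn (fun τ => (B τ).im * (c τ).im) (Ioc s t) := by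
    have h1 : IntegrableOn (fun τ => (c τ).im * (B τ).im) (Ioc s t) := by
      refine hBim.bdd_mul hcim (c := C) ?_
      filter_upwards [hcb'] with τ hτ
      exact (Complex.abs_im_le_norm _).trans hτ
    exact h1.congr_fun (fun τ _ => mul_comm _ _) measurableSet_Ioc
  have hsplit : ∫ τ in Ioc s t, 2 * (conj (c τ) * B τ).re =
      2 * ((∫ τ in Ioc s t, (B τ).re * (c τ).re) + ∫ τ in Ioc s t, (B τ).im * (c τ).im) := by
    rw [integral_const_mul, ← integral_add i1 i2]
    congr 1
    refine integral_congr_ae (ae_of_all _ fun τ => ?_)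
    dsimp only
    rw [ssl_re_conj_mul]
    ring
  rw [hsplit, Complex.sq_norm, Complex.sq_norm, Complex.normSq_apply, Complex.normSq_apply]
  linear_combination e1 + e2

variable {κ : ℝ} {u : ℝ → UnitAddTorus d → EuclideanSpace ℝ d} {hs θ₀ : UnitAddTorus d → ℝ}
  {θ : ℝ → UnitAddTorus d → ℝ} {B c : ℝ → (d → ℤ) → ℂ}

/-- **One mode of the truncated balance**: for `0 ≤ s ≤ t` and every `k`,
`‖c(t,k)‖² - ‖c(s,k)‖² = ∫_{(s,t]} 2 Re (conj c(τ,k) B(τ,k)) dτ`, with an integrable integrand. [folklore] -/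
theorem ssl_sq_norm_mode_sub_eq
    (hB : B = fun s k => -(((4 * Real.pi ^ 2 * κ * freqNormSq k : ℝ)) : ℂ) *
        mFourierCoeff (fun x => (θ s x : ℂ)) k -
      ∑ j, (2 * Real.pi * I * (k j)) * mFourierCoeff (fun x => ((θ s x * u s x j : ℝ) : ℂ)) k +
        mFourierCoeff (fun x => (hs x : ℂ)) k)
    (hc : c = fun t k => mFourierCoeff (fun x => (θ₀ x : ℂ)) k + ∫ s in Ioc 0 t, B s k)
    (hsol : ∀ T, 0 < T → IsWeakScalarTransportForcedOn T κ u (fun _ => hs) θ₀ θ) (k : d → ℤ)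
    {s t : ℝ} (hs0 : 0 ≤ s) (hst : s ≤ t) :
    IntegrableOn (fun τ => 2 * (conj (c τ k) * B τ k).re) (Ioc s t) ∧
      ‖c t k‖ ^ 2 - ‖c s k‖ ^ 2 = ∫ τ in Ioc s t, 2 * (conj (c τ k) * B τ k).re := by
  rcases eq_or_lt_of_le (hs0.trans hst) with ht | ht
  · have hs' : s = 0 := le_antisymm (ht.symm ▸ hst) hs0
    subst hs'
    rw [← ht]
    simp
  have hBI : IntegrableOn (fun τ => B τ k) (Ioc s t) :=
    (ssl_integrableOn_modeRHS_Ioc hB (hsol t ht) k).mono_set (Ioc_subset_Ioc_left hs0)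
  have hcont : ContinuousOn (fun τ => c τ k) (Icc s t) :=
    (ssl_continuousOn_mode hB hc hsol k).mono fun τ hτ => hs0.trans hτ.1
  obtain ⟨C, hC⟩ := isCompact_Icc.exists_bound_of_continuousOn hcont
  have hcm : AEStronglyMeasurable (fun τ => c τ k) (volume.restrict (Ioc s t)) :=
    (hcont.mono Ioc_subset_Icc_self).aestronglyMeasurable measurableSet_Ioc
  exact ssl_sq_norm_sub_eq_setIntegral hst hBI hcm (fun τ hτ => hC τ (Ioc_subset_Icc_self hτ))
    fun τ hτ => ssl_mode_add hB hc hsol k hs0 hτ.1.le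

/-- **The truncated energy balance, modal form**: for `0 ≤ s ≤ t` and every `N`,
`E_N(t) - E_N(s) = ∫_{(s,t]} ∑_{|k|≤N} 2 Re (conj c(τ,k) B(τ,k)) dτ` with
`E_N(t) = ∑_{|k|≤N} ‖c(t,k)‖²`, the integrand being integrable on `(s,t]`. [folklore] -/
theorem ssl_energy_trunc_sub_eq [DecidableEq d]
    (hB : B = fun s k => -(((4 * Real.pi ^ 2 * κ * freqNormSq k : ℝ)) : ℂ) *
        mFourierCoeff (fun x => (θ s x : ℂ)) k -
      ∑ j, (2 * Real.pi * I * (k j)) * mFourierCoeff (fun x => ((θ s x * u s x j : ℝ) : ℂ)) k +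
        mFourierCoeff (fun x => (hs x : ℂ)) k)
    (hc : c = fun t k => mFourierCoeff (fun x => (θ₀ x : ℂ)) k + ∫ s in Ioc 0 t, B s k)
    (hsol : ∀ T, 0 < T → IsWeakScalarTransportForcedOn T κ u (fun _ => hs) θ₀ θ) (N : ℕ)
    {s t : ℝ} (hs0 : 0 ≤ s) (hst : s ≤ t) :
    IntegrableOn (fun τ => ∑ k ∈ freqBall N, 2 * (conj (c τ k) * B τ k).re) (Ioc s t) ∧
      (∑ k ∈ freqBall N, ‖c t k‖ ^ 2) - ∑ k ∈ freqBall N, ‖c s k‖ ^ 2 =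
        ∫ τ in Ioc s t, ∑ k ∈ freqBall N, 2 * (conj (c τ k) * B τ k).re := by
  have hk := fun k => ssl_sq_norm_mode_sub_eq hB hc hsol k hs0 hst
  refine ⟨integrable_finsetSum (freqBall N) fun k _ => (hk k).1, ?_⟩
  rw [integral_finsetSum _ fun k _ => (hk k).1, ← Finset.sum_sub_distrib]
  exact Finset.sum_congr rfl fun k _ => (hk k).2

/-! ### The modal sums in physical space -/

omit [Fintype d] in
/-- **Damping**: `∑_{|k|≤N} Re (conj aₖ · (-4π²κ|k|² aₖ)) = -κ · 4π² ∑_{|k|≤N} |k|² ‖aₖ‖²`. [folklore] -/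
theorem ssl_sum_re_conj_mul_damping (S : Finset (d → ℤ)) (a : (d → ℤ) → ℂ) (κ : ℝ) [Fintype d] :
    ∑ k ∈ S, (conj (a k) * (-(((4 * Real.pi ^ 2 * κ * freqNormSq k : ℝ)) : ℂ) * a k)).re =
      -κ * (4 * Real.pi ^ 2 * ∑ k ∈ S, freqNormSq k * ‖a k‖ ^ 2) := by
  rw [Finset.mul_sum, Finset.mul_sum]
  refine Finset.sum_congr rfl fun k _ => ?_
  have h1 : conj (a k) * (-(((4 * Real.pi ^ 2 * κ * freqNormSq k : ℝ)) : ℂ) * a k) =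
      (((-(4 * Real.pi ^ 2 * κ * freqNormSq k * ‖a k‖ ^ 2) : ℝ)) : ℂ) := by
    rw [Complex.sq_norm]
    push_cast
    rw [Complex.normSq_eq_conj_mul_self]
    ring
  rw [h1, Complex.ofReal_re]
  ring

/-- **Source**: for a conjugate-symmetric family `a` and a real `h ∈ L²`,
`∑_{|k|≤N} Re (conj aₖ · 𝓕h(k)) = ∫ h · P_N` with `P_N = reTrigPoly (freqBall N) a` (Parseval
pairing; the coefficients of `P_N` are `a` on the ball and `0` off it). [cite: Grafakos2014, Prop. 3.2.7 (3)] -/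
theorem ssl_sum_re_conj_mul_source [DecidableEq d] (N : ℕ) {a : (d → ℤ) → ℂ} (ha : IsConjSymmScalar a)
    {h : UnitAddTorus d → ℝ} (hh : MemLp h 2 volume) :
    ∑ k ∈ freqBall N, (conj (a k) * mFourierCoeff (fun x => (h x : ℂ)) k).re =
      ∫ x, h x * reTrigPoly (freqBall N) a x := by
  have hP : MemLp (reTrigPoly (freqBall N) a) 2 volume := memLp_reTrigPoly _ _ 2
  have key := ssl_integral_mul_eq_tsum hP hh
  simp only [mFourierCoeff_ofReal_reTrigPoly neg_mem_freqBall_of_mem ha] at key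
  rw [tsum_eq_sum (s := freqBall N) (fun k hk => by rw [if_neg hk, map_zero, zero_mul])] at key
  rw [Finset.sum_congr rfl fun k (hk : k ∈ freqBall N) => by rw [if_pos hk]] at key
  have e : ∫ x, h x * reTrigPoly (freqBall N) a x = ∫ x, reTrigPoly (freqBall N) a x * h x :=
    integral_congr_ae (ae_of_all _ fun x => mul_comm _ _)
  rw [e, ← Complex.ofReal_re (∫ x, reTrigPoly (freqBall N) a x * h x), key, Complex.re_sum]

/-- The product `θ uⱼ` of an `L²` scalar and a component of a drift bounded by `M` is in `L²`. [folklore] -/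
theorem ssl_memLp_mul_velocity {θ' : UnitAddTorus d → ℝ} {u' : UnitAddTorus d → EuclideanSpace ℝ d}
    (hθ' : MemLp θ' 2 volume) (hu' : AEStronglyMeasurable u' volume) {M : ℝ}
    (hM : ∀ᵐ x ∂volume, ‖u' x‖ ≤ M) (j : d) : MemLp (fun x => θ' x * u' x j) 2 volume := by
  refine MemLp.of_le_mul (c := M) hθ'
    (hθ'.1.mul ((EuclideanSpace.proj j).continuous.comp_aestronglyMeasurable hu')) ?_
  filter_upwards [hM] with x hx
  rw [norm_mul, mul_comm]
  exact mul_le_mul_of_nonneg_right ((FunctionSpaces.Torus.abs_apply_le_norm (u' x) j).trans hx)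
    (norm_nonneg _)

/-- **Transport**: for a conjugate-symmetric family `a`, a real `θ' ∈ L²` and a measurable drift
`u'` bounded by `M`,
`∑_{|k|≤N} Re (conj aₖ · (-∑ⱼ 2πi kⱼ 𝓕(θ' u'ⱼ)(k))) = ∫ θ' ⟪u', ∇P_N⟫` with
`P_N = reTrigPoly (freqBall N) a` (Parseval pairings of `θ'u'ⱼ` against
`∂ⱼ P_N = reTrigPoly (2πi kⱼ aₖ)`; `conj (2πi kⱼ) = -2πi kⱼ`). [cite: Grafakos2014, Prop. 3.2.6 (8)] -/
theorem ssl_sum_re_conj_mul_transport [DecidableEq d] (N : ℕ) {a : (d → ℤ) → ℂ}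
    (ha : IsConjSymmScalar a) {θ' : UnitAddTorus d → ℝ} {u' : UnitAddTorus d → EuclideanSpace ℝ d}
    (hθ' : MemLp θ' 2 volume) (hu' : AEStronglyMeasurable u' volume) {M : ℝ}
    (hM : ∀ᵐ x ∂volume, ‖u' x‖ ≤ M) :
    ∑ k ∈ freqBall N, (conj (a k) *
        -(∑ j, (2 * Real.pi * I * (k j)) * mFourierCoeff (fun x => ((θ' x * u' x j : ℝ) : ℂ)) k)).re =
      ∫ x, θ' x * ⟪u' x, Torus.gradient (reTrigPoly (freqBall N) a) x⟫_ℝ := by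
  set S := freqBall (d := d) N with hS
  have hSsym : ∀ k ∈ S, -k ∈ S := fun k hk => neg_mem_freqBall_of_mem k hk
  set P := reTrigPoly S a with hP
  have hP1 : IsContDiff 1 P := (isSmooth_reTrigPoly S a).isContDiff (by simp)
  -- expand the gradient pairing in components
  have hpt : ∀ x, θ' x * ⟪u' x, Torus.gradient P x⟫_ℝ = ∑ j, partialDeriv j P x * (θ' x * u' x j) := by
    intro x
    rw [inner_gradient_eq_sum_mul_partialDeriv hP1, Finset.mul_sum]
    refine Finset.sum_congr rfl fun j _ => ?_
    ring
  have hmem : ∀ j, MemLp (fun x => θ' x * u' x j) 2 volume := fun j => ssl_memLp_mul_velocity hθ' hu' hM j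
  have hint : ∀ j, Integrable (fun x => partialDeriv j P x * (θ' x * u' x j)) volume := fun j => by
    obtain ⟨Cj, hCj⟩ := isCompact_univ.exists_bound_of_continuousOn
      ((isSmooth_reTrigPoly S a).partialDeriv j).continuous.continuousOn
    exact ((hmem j).integrable one_le_two).bdd_mul
      ((isSmooth_reTrigPoly S a).partialDeriv j).continuous.aestronglyMeasurable
      (ae_of_all _ fun x => hCj x (mem_univ x))
  simp_rw [hpt]
  rw [integral_finsetSum _ fun j _ => hint j]
  -- each component by Parseval
  have hcomp : ∀ j, ((∫ x, partialDeriv j P x * (θ' x * u' x j) : ℝ) : ℂ) =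
      ∑ k ∈ S, -((2 * Real.pi * I * (k j)) * (conj (a k) *
        mFourierCoeff (fun x => ((θ' x * u' x j : ℝ) : ℂ)) k)) := by
    intro j
    have hdP : (fun x => partialDeriv j P x) = reTrigPoly S (fun k => (2 * Real.pi * I * (k j)) • a k) :=
      funext fun x => partialDeriv_reTrigPoly S a j x
    have hmemd : MemLp (fun x => partialDeriv j P x) 2 volume := by
      rw [hdP]; exact memLp_reTrigPoly _ _ 2
    have key := ssl_integral_mul_eq_tsum hmemd (hmem j)
    rw [key]
    simp only [hdP, mFourierCoeff_ofReal_reTrigPoly hSsym (ha.deriv j)]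
    rw [tsum_eq_sum (s := S) (fun k hk => by rw [if_neg hk, map_zero, zero_mul])]
    refine Finset.sum_congr rfl fun k hk => ?_
    rw [if_pos hk]
    simp only [smul_eq_mul, map_mul, Complex.conj_ofReal, Complex.conj_I, map_ofNat, map_intCast]
    ring
  have hZ : ((∑ j, ∫ x, partialDeriv j P x * (θ' x * u' x j) : ℝ) : ℂ) =
      ∑ k ∈ S, conj (a k) *
        -(∑ j, (2 * Real.pi * I * (k j)) * mFourierCoeff (fun x => ((θ' x * u' x j : ℝ) : ℂ)) k) := by
    rw [Complex.ofReal_sum]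
    simp only [hcomp]
    rw [Finset.sum_comm]
    refine Finset.sum_congr rfl fun k _ => ?_
    rw [mul_neg, Finset.mul_sum, ← Finset.sum_neg_distrib]
    refine Finset.sum_congr rfl fun j _ => ?_
    ring
  symm
  rw [← Complex.ofReal_re (∑ j, ∫ x, partialDeriv j P x * (θ' x * u' x j)), hZ, Complex.re_sum]

end Summit.AnomalousDissipation.AnomalousDissipation.Theorems

end
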